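/-
Copyright: H21 programme, solo seat `solo-RiemannHypothesis-informed` (session 4).
-/
import Summits.RiemannHypothesis.RiemannHypothesis.Theorems.SoloInformedBumpDipole

/-!
# The double-logarithmic visibility theorem (solo-informed, T16)

Assembly of the local threshold theorem (T13, `weilGroundEnergy_neg_of_local_oddDipole`) with
the displaced-bump dipole (T15): for a fixed smooth bump `ψ ≥ 0` in `[−1, 1]`, a hypothetical
zero `½ + η + iγ₀` (`0 < η < ½`, `γ₀ ≠ 0`) and local RH of radius `R` with `R² ≥ e^{c+1}` near
`γ₀`, the Weil ground energy of the window `[−(c+1), c+1]` is negative as soon as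
`K(ψ) log(|γ₀| + 2) < η⁴ (e^{ηc}Φ(η) − Φ(−η))²` (`weilGroundEnergy_neg_of_local_bumpDipole`):
the visibility window of a fixed-offset zero is DOUBLY logarithmic in its height,
`c ≈ (2η)⁻¹ log log|γ₀|`, granted local RH of poly-logarithmic radius. (Hypothesis-free, the
far off-line zeros cost `e^{a}` — T10 — and only the single-log window survives.)

The undodged curvature test `D_0 h = −h''` is used (`weilDodge_zero_eq`,
`integral_norm_sq_weilDodge_zero_pos`).
-/

open MeasureTheory Complex Set Filter Topology Literature.NumberTheory.LFunctions
open scoped ContDiff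

namespace Summit.RiemannHypothesis.RiemannHypothesis.Theorems

/-! ## The undodged curvature test `D_0 h = −h''` -/

/-- `D_0 h = −h''`. -/
theorem weilDodge_zero_eq (h : ℝ → ℂ) : weilDodge 0 h = fun t ↦ -(iteratedDeriv 2 h t) := by
  funext t
  simp [weilDodge, iteratedDeriv_succ]

/-- `(D_0 h)' = −h'''`. -/
theorem deriv_weilDodge_zero (h : ℝ → ℂ) :
    deriv (weilDodge 0 h) = fun t ↦ -(iteratedDeriv 3 h t) := by
  rw [weilDodge_zero_eq]
  funext t
  rw [show (fun t ↦ -(iteratedDeriv 2 h t)) = -(iteratedDeriv 2 h) from rfl, deriv.neg,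
    ← iteratedDeriv_succ]

/-- `(D_0 h)'' = −h''''`. -/
theorem iteratedDeriv_two_weilDodge_zero (h : ℝ → ℂ) :
    iteratedDeriv 2 (weilDodge 0 h) = fun t ↦ -(iteratedDeriv 4 h t) := by
  rw [weilDodge_zero_eq]
  funext t
  rw [iteratedDeriv_fun_neg]
  congr 1
  simp only [iteratedDeriv_eq_iterate]
  rw [show (4 : ℕ) = 2 + 2 from rfl, Function.iterate_add_apply]

/-- `D_0 h ≠ 0` in `L²` as soon as some real exponential moment of `h` is non-zero. -/
theorem integral_norm_sq_weilDodge_zero_pos {h : ℝ → ℂ} (hh : IsWeilTest h) {η : ℝ} (hη : η ≠ 0)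
    (hgain : ∫ t, h t * cexp ((η : ℂ) * t) ≠ 0) : 0 < ∫ t, ‖weilDodge 0 h t‖ ^ 2 := by
  have hk : IsWeilTest (weilDodge 0 h) := isWeilTest_weilDodge hh 0
  have hkc : Continuous (weilDodge 0 h) := hk.1.continuous
  have hcont : Continuous fun t ↦ ‖weilDodge 0 h t‖ ^ 2 := by fun_prop
  have hint : Integrable fun t ↦ ‖weilDodge 0 h t‖ ^ 2 :=
    hcont.integrable_of_hasCompactSupport (hk.2.norm.comp_left (g := fun x : ℝ ↦ x ^ 2) (by simp))
  have hnn : 0 ≤ ∫ t, ‖weilDodge 0 h t‖ ^ 2 := integral_nonneg fun t ↦ by positivity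
  rcases hnn.lt_or_eq with hlt | heq
  · exact hlt
  exfalso
  have hae : (fun t ↦ ‖weilDodge 0 h t‖ ^ 2) =ᵐ[volume] 0 :=
    (integral_eq_zero_iff_of_nonneg (fun t ↦ by positivity) hint).mp heq.symm
  have hfun : (fun t ↦ ‖weilDodge 0 h t‖ ^ 2) = fun _ ↦ (0 : ℝ) :=
    (Continuous.ae_eq_iff_eq volume hcont continuous_const).mp hae
  have hzero : ∀ t, weilDodge 0 h t = 0 := by
    intro t
    have ht := congrFun hfun t
    simpa using ht
  have hM : weilMellin (weilDodge 0 h) (1 / 2 + η) = 0 := by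
    unfold weilMellin; simp [hzero]
  rw [weilMellin_weilDodge (contDiff_two_of_isWeilTest hh) hh.2 0 (1 / 2 + η)] at hM
  have hM' : weilMellin h (1 / 2 + η) = 0 := by
    rcases mul_eq_zero.mp hM with h0 | h0
    · exfalso
      apply hη
      have h0' : ((η : ℂ)) ^ 2 = 0 := by linear_combination -h0
      exact_mod_cast pow_eq_zero_iff (n := 2) (by norm_num) |>.mp h0'
    · exact h0
  apply hgain
  rw [← hM']
  unfold weilMellin
  congr 1; funext t; congr 2; ring

/-- Bookkeeping: the local sampling majorant of a test whose three derivative norms are at most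
`2N₂, 2N₃, 2N₄`, with `e ≤ R²`, is at most `4(N₂² + N₃² + 2N₄²)`. -/
theorem local_majorant_arith {X₁ X₂ X₃ N₂ N₃ N₄ e R2 : ℝ} (h₁ : 0 ≤ X₁) (h₂ : 0 ≤ X₂)
    (h₃ : 0 ≤ X₃) (hk₁ : X₁ ≤ 2 * N₂) (hk₂ : X₂ ≤ 2 * N₃) (hk₃ : X₃ ≤ 2 * N₄) (he : 0 < e)
    (hR : e ≤ R2) :
    (X₁ ^ 2 + X₂ ^ 2) + 2 * e * X₃ ^ 2 / R2 ≤ 4 * (N₂ ^ 2 + N₃ ^ 2 + 2 * N₄ ^ 2) := by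
  have hX1 : X₁ ^ 2 ≤ 4 * N₂ ^ 2 := (pow_le_pow_left₀ h₁ hk₁ 2).trans_eq (by ring)
  have hX2 : X₂ ^ 2 ≤ 4 * N₃ ^ 2 := (pow_le_pow_left₀ h₂ hk₂ 2).trans_eq (by ring)
  have hX3 : X₃ ^ 2 ≤ 4 * N₄ ^ 2 := (pow_le_pow_left₀ h₃ hk₃ 2).trans_eq (by ring)
  have hR2 : 0 < R2 := he.trans_le hR
  have hE : 2 * e * X₃ ^ 2 / R2 ≤ 8 * N₄ ^ 2 := by
    rw [div_le_iff₀ hR2]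
    have i1 := mul_le_mul_of_nonneg_left hX3 (by positivity : (0 : ℝ) ≤ 2 * e)
    have i2 := mul_le_mul_of_nonneg_left hR (by positivity : (0 : ℝ) ≤ 8 * N₄ ^ 2)
    linarith
  linarith

/-! ## The double-logarithmic visibility theorem -/

variable {ψ : ℝ → ℝ}

/-- **Double-log visibility theorem (T16).** Fix a smooth bump `ψ ≥ 0` supported in `[−1, 1]`,
with Laplace transform `Φ(θ) = ∫ ψ e^{θs}`. There is `K = K(ψ) > 0` (namely
`4A₁(‖ψ''‖₁² + ‖ψ'''‖₁² + 2‖ψ''''‖₁²) + 1`, `A₁` the Riemann–von Mangoldt unit-interval constant)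
such that: if `ζ(½ + η + iγ₀) = 0` with `0 < η < ½`, `γ₀ ≠ 0`, if RH holds locally — every zero
`ρ` with `0 ≤ Re ρ ≤ 1`, `|Im ρ − γ₀| < R` lies on the critical line or is one of `½ ± η + iγ₀` —
with radius `R ≥ 1`, `R² ≥ e^{c+1}`, and if the displacement `c ≥ 0` satisfies
`Φ(−η) ≤ e^{ηc} Φ(η)` and `K·log(|γ₀| + 2) < η⁴ (e^{ηc} Φ(η) − Φ(−η))²`, then the Weil ground
energy of the window `[−(c+1), c+1]` is NEGATIVE: `ε(c+1) < 0` (Weil positivity fails visibly at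
scale `c + 1`). Since the last condition holds as soon as `e^{2ηc} ≳_ψ,η K log|γ₀|`, the window is
`c ≈ (2η)⁻¹ log log |γ₀|` — DOUBLY logarithmic in the height — under local RH of radius
`R = e^{(c+1)/2} = (log|γ₀|)^{O(1/η)}`. Test used: the undodged curvature `−h_c''` of the
displaced-bump dipole `h_c = ψ(· − c) − ψ(−· − c)`. -/
theorem weilGroundEnergy_neg_of_local_bumpDipole (hψ : ContDiff ℝ ∞ ψ)
    (hsupp : tsupport ψ ⊆ Icc (-1) 1) (hψ0 : ∀ s, 0 ≤ ψ s) :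
    ∃ K : ℝ, 0 < K ∧ ∀ (η γ₀ c R : ℝ), 0 < η → η < 1 / 2 → γ₀ ≠ 0 → 0 ≤ c → 1 ≤ R →
      Real.exp (c + 1) ≤ R ^ 2 →
      riemannZeta (1 / 2 + η + γ₀ * I) = 0 →
      (∀ ρ : ℂ, riemannZeta ρ = 0 → 0 ≤ ρ.re → ρ.re ≤ 1 → |ρ.im - γ₀| < R → ρ.re ≠ 1 / 2 →
          ρ = 1 / 2 + η + γ₀ * I ∨ ρ = 1 / 2 - η + γ₀ * I) →
      bumpLaplace ψ (-η) ≤ Real.exp (η * c) * bumpLaplace ψ η →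
      (K * Real.log (|γ₀| + 2) <
          η ^ 4 * (Real.exp (η * c) * bumpLaplace ψ η - bumpLaplace ψ (-η)) ^ 2) →
      weilGroundEnergy (c + 1) < 0 := by
  obtain ⟨A₁, hA₁, hT⟩ := weilGroundEnergy_neg_of_local_oddDipole
  set N₂ : ℝ := ∫ s, |iteratedDeriv 2 ψ s| with hN₂
  set N₃ : ℝ := ∫ s, |iteratedDeriv 3 ψ s| with hN₃
  set N₄ : ℝ := ∫ s, |iteratedDeriv 4 ψ s| with hN₄
  refine ⟨4 * A₁ * (N₂ ^ 2 + N₃ ^ 2 + 2 * N₄ ^ 2) + 1, by positivity,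
    fun η γ₀ c R hη hη2 hγ hc hR hRa hζ hloc hgainpos hwin ↦ ?_⟩
  -- the test function and its properties
  have hh : IsWeilTest (bumpDipole ψ c) := isWeilTest_bumpDipole hψ hsupp hc
  have hodd : ∀ t, bumpDipole ψ c (-t) = -bumpDipole ψ c t := bumpDipole_odd ψ c
  have hhs : tsupport (bumpDipole ψ c) ⊆ Icc (-(c + 1)) (c + 1) :=
    tsupport_bumpDipole_subset hsupp hc
  -- the gain
  set g : ℝ := Real.exp (η * c) * bumpLaplace ψ η - bumpLaplace ψ (-η) with hg_def
  have hg0 : 0 ≤ g := sub_nonneg.mpr hgainpos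
  have hgain : g ≤ ‖∫ t, bumpDipole ψ c t * cexp ((η : ℂ) * t)‖ :=
    gain_bumpDipole hψ.continuous hsupp hψ0 hη.le hc
  have hL : 0 < Real.log (|γ₀| + 2) := Real.log_pos (by linarith [abs_nonneg γ₀])
  have hgpos : 0 < g := by
    rcases hg0.lt_or_eq with h | h
    · exact h
    · exfalso
      rw [← h] at hwin
      have : 0 < (4 * A₁ * (N₂ ^ 2 + N₃ ^ 2 + 2 * N₄ ^ 2) + 1) * Real.log (|γ₀| + 2) := by
        positivity
      linarith
  have hint_ne : ∫ t, bumpDipole ψ c t * cexp ((η : ℂ) * t) ≠ 0 := by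
    intro h0
    rw [h0, norm_zero] at hgain
    linarith
  have hpos : 0 < ∫ t, ‖weilDodge 0 (bumpDipole ψ c) t‖ ^ 2 :=
    integral_norm_sq_weilDodge_zero_pos hh hη.ne' hint_ne
  -- the `c`-independent norms
  have hk1 : ∫ t, ‖weilDodge 0 (bumpDipole ψ c) t‖ ≤ 2 * N₂ := by
    rw [weilDodge_zero_eq]
    simp only [norm_neg]
    exact integral_norm_iteratedDeriv_bumpDipole_le hψ hsupp c 2
  have hk2 : ∫ t, ‖deriv (weilDodge 0 (bumpDipole ψ c)) t‖ ≤ 2 * N₃ := by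
    rw [deriv_weilDodge_zero]
    simp only [norm_neg]
    exact integral_norm_iteratedDeriv_bumpDipole_le hψ hsupp c 3
  have hk3 : ∫ t, ‖iteratedDeriv 2 (weilDodge 0 (bumpDipole ψ c)) t‖ ≤ 2 * N₄ := by
    rw [iteratedDeriv_two_weilDodge_zero]
    simp only [norm_neg]
    exact integral_norm_iteratedDeriv_bumpDipole_le hψ hsupp c 4
  have hMloc : ((∫ t, ‖weilDodge 0 (bumpDipole ψ c) t‖) ^ 2
      + (∫ t, ‖deriv (weilDodge 0 (bumpDipole ψ c)) t‖) ^ 2)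
      + 2 * Real.exp (c + 1) * (∫ t, ‖iteratedDeriv 2 (weilDodge 0 (bumpDipole ψ c)) t‖) ^ 2
          / R ^ (2 * 1) ≤ 4 * (N₂ ^ 2 + N₃ ^ 2 + 2 * N₄ ^ 2) :=
    local_majorant_arith (integral_nonneg fun _ ↦ norm_nonneg _)
      (integral_nonneg fun _ ↦ norm_nonneg _) (integral_nonneg fun _ ↦ norm_nonneg _) hk1 hk2 hk3
      (Real.exp_pos _) (by simpa using hRa)
  have h1 : 2 * A₁ * (((∫ t, ‖weilDodge 0 (bumpDipole ψ c) t‖) ^ 2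
      + (∫ t, ‖deriv (weilDodge 0 (bumpDipole ψ c)) t‖) ^ 2)
      + 2 * Real.exp (c + 1) * (∫ t, ‖iteratedDeriv 2 (weilDodge 0 (bumpDipole ψ c)) t‖) ^ 2
          / R ^ (2 * 1)) * Real.log (|γ₀| + 2)
      ≤ 2 * A₁ * (4 * (N₂ ^ 2 + N₃ ^ 2 + 2 * N₄ ^ 2)) * Real.log (|γ₀| + 2) :=
    mul_le_mul_of_nonneg_right (mul_le_mul_of_nonneg_left hMloc (by positivity)) hL.le
  -- the zero has multiplicity ≥ 1
  have hne1 : (1 / 2 + η + γ₀ * I : ℂ) ≠ 1 := by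
    intro h
    apply hγ
    have := congrArg Complex.im h
    simpa using this
  have hm1 : (1 : ℝ) ≤ (riemannZetaZeroOrder (1 / 2 + η + γ₀ * I) : ℝ) := by
    have := (riemannZetaZeroOrder_pos_iff hne1).mpr hζ
    have h1m : (1 : ℤ) ≤ riemannZetaZeroOrder (1 / 2 + η + γ₀ * I) := by omega
    exact_mod_cast h1m
  have hG : η ^ 4 * g ^ 2 ≤
      (η ^ 2 + (0 : ℝ) ^ 2) ^ 2 * ‖∫ t, bumpDipole ψ c t * cexp ((η : ℂ) * t)‖ ^ 2 := by
    rw [show (η ^ 2 + (0 : ℝ) ^ 2) ^ 2 = η ^ 4 by ring]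
    exact mul_le_mul_of_nonneg_left (pow_le_pow_left₀ hg0 hgain 2) (by positivity)
  have hP : 0 ≤ (η ^ 2 + (0 : ℝ) ^ 2) ^ 2 * ‖∫ t, bumpDipole ψ c t * cexp ((η : ℂ) * t)‖ ^ 2 := by
    positivity
  have hmP := mul_le_mul_of_nonneg_right hm1 hP
  have h2 : 2 * A₁ * (4 * (N₂ ^ 2 + N₃ ^ 2 + 2 * N₄ ^ 2)) * Real.log (|γ₀| + 2) <
      2 * ((riemannZetaZeroOrder (1 / 2 + η + γ₀ * I) : ℝ)
        * ((η ^ 2 + (0 : ℝ) ^ 2) ^ 2 * ‖∫ t, bumpDipole ψ c t * cexp ((η : ℂ) * t)‖ ^ 2)) := by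
    linarith [hwin, hG, hmP, hL]
  have key := hT (bumpDipole ψ c) (c + 1) 0 η γ₀ R 1 hh hodd (by linarith) hR hhs
    (by simpa only [Complex.ofReal_zero] using hpos) hζ (abs_lt.mpr ⟨by linarith, hη2⟩) hη.ne'
    hγ hloc
  refine key ?_
  simpa only [Complex.ofReal_zero] using lt_of_le_of_lt h1 h2

end Summit.RiemannHypothesis.RiemannHypothesis.Theorems
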